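import Summits.QuantumFields.BalabanUV.Beta.SymBorderReflectionLetters
import Summits.QuantumFields.BalabanUV.Beta.CombChartStepJets

/-!
# `BalabanUV.Beta.CombBorderReflectionLetters` — binder row D1, RULING R-D1-g35-1 (chart (III′)), brick P6-7: **THE SECOND-ORDER BORDER TABLE REFLECTION LETTERS (W-0B)
# OF an1's `symVh₂SAn1` AGAINST THE COMB LITERAL's LEVEL-`j+1` PURE TABLES** — the (III′) twin of `SymBorderReflectionLetters` §Root (gen 32): `hBfm_comb`, `hBmf_comb`,
# `hBmm_comb` = `hBfm_sym`∕`hBmf_sym`∕`hBmm_sym` with `SpureRecOf … (Gsym Lc) … (j+1)` ↦ `SpureRecOf … (GcombSh Lc) … (j+1)`; the proofs are chart (II)'s verbatim, since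
# they only read the BORDER blocks of the level-`j+1` pure tables (`SymBorderReflectionLetters.SpureRecOf_succ_inl_inr`∕`_inr_inl`∕`_inr_inr`, resolvent-generic) and
# the border blocks of `bhKStepSh 3 Lc (Dsh Lc) (j+1)`; `hRBrff_zero` is chart (II)'s BY NAME.

HONEST FRAMING (cell contract, verbatim): «discharging `BetaPertH` makes Bałaban's UV stability UNCONDITIONAL — a real constructive-QFT
result; it is NOT the continuum limit and NOT the Clay problem.»  HONEST DEPENDENCY: continuum YM on T⁴ ⇐ BetaPertH ∧ nine spine estimates (0/9 proved);
BetaPertH ⇐ (D1) ∧ (D4) ∧ CAP+tail; G-an2-4 gates asym, D1 and NE2/3/4.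
DERIVED cell leaf ([folklore] kernel bookkeeping BY NAME; β sub-cell, BINDER-OWNERS row D1 OWNER `b2b-balaban-beta-an2` gen 36, programme P6).  No statement of Bałaban's
papers, no `[cite:]`, no `Prop` fact, no `def`.  Discharges NO binder by itself; RECORD = ROOT M′ p303989 (chart (II)) unchanged; NOT D1, NOT `BetaPertH`, NOT continuum, NOT Clay.
Provenance: β sub-cell, unit beta-an2 gen 36, 2026-08-22 (v1); text of `SymBorderReflectionLetters` §Root transformed by name; no existing file touched.
-/

noncomputable section

open Finset
open scoped BigOperators
open Literature.Probability.LatticeModels (Torus.proj)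
open Literature.MathematicalPhysics.QuantumFieldTheory
open Literature.MathematicalPhysics.QuantumFieldTheory.Balaban1983to89
open Literature.MathematicalPhysics.QuantumFieldTheory.Balaban1983to89.Beta
open ExpKernelCalculus (MKer comp)
open PolarizationSign (reflSign)
open KernelReflection (refK refK_apply)
open ResolventReflection (bref Φ Φ_r_inl Φ_r_inr Φ_s_inl Φ_s_inr bref_bref reflSign_mul_self mref)
open RootedKernelReflection (off_mref_eq_zero_iff blk_mref)
open AffineAveraging (box toSite)
open AveragingContours (blk off)
open AveragingContoursRooted (ctr ctrOff ctrOff_mem_box)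
open AveragingHessianKernels (Bond packVH packVH_inl_inr packVH_inr_inl packVH_inl_inl packVH_inr_inr)
open LatticeForm (quo)
open OneStepResolventKernel (Fib)
open OneStepKernelFamily (KInvStep)
open StepJetData (wilsonA)
open BalabanStepJetsSucc (wE wVH)
open BalabanStepW2 (wB2)
open Summit.QuantumFields.BalabanUV.Beta.TameKernelCalculus
open Summit.QuantumFields.BalabanUV.Beta.ChartConjugation (conjV conjW conjW₁ conjW₂)
open Summit.QuantumFields.BalabanUV.Beta.AxialDressingRooted (one_le_of_neZero)
open Summit.QuantumFields.BalabanUV.Beta.CombChartStepJets (GcombSh)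
open Summit.QuantumFields.BalabanUV.Beta.SpineRooted (SpureRecOf SpureRecOf_succ e3OfK e3OfK_inl_inr e3OfK_inr_inl e3OfK_inr_inr)
open Summit.QuantumFields.BalabanUV.Beta.WardLocusRecursive (SrecOf)
open Summit.QuantumFields.BalabanUV.Beta.SymShiftedSpread (bhKStepSh bhKStepSh_apply)
open Summit.QuantumFields.BalabanUV.Beta.BorderedHessian (bhK bhK_inr_inr bhKStep bhKStep_succ_inl_inr bhKStep_succ_inr_inl bhKStep_succ_inr_inr stepScale
  diagK diagK_apply comp_diagK_left comp_diagK_right off_eq_zero_iff_proj blk_eq_quo)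
open Summit.QuantumFields.BalabanUV.Beta.E3ContactGenerator (ctGenM ctGenM_inl ctGenM_inr)
open Summit.QuantumFields.BalabanUV.Beta.DshAn1 (Dsh Dsh_inr_inr)
open Summit.QuantumFields.BalabanUV.Beta.SymAveragingHessianCounts (symVhSAt symVhKerAt symLinKerAt symHessFFAt symVhSAt_inl_inl)
open Summit.QuantumFields.BalabanUV.Beta.SymAveragingMixedJetTables (symVh2KerAt)
open Summit.QuantumFields.BalabanUV.Beta.SymSecondOrderTablesAn1 (symVh₂SAn1 symVh₂SAn1_inl_inl symVh₂SAn1_inr_inr symVh₂SAn1_antiTwin)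
open Summit.QuantumFields.BalabanUV.Beta.SymWardLettersUnpacking (symVhSAt_inl_inr' symVh₂SAn1_inl_inr)
open Summit.QuantumFields.BalabanUV.Beta.SymVhSliceReflectionAn1 (symB_inl_inr symB_inr_inl symB_inr_inr)
open Summit.QuantumFields.BalabanUV.Beta.SymRootedBorderTableLaw (symBondLaw)
open Summit.QuantumFields.BalabanUV.Beta.FP.SliceBiContactChart (conjW_diagK_apply)
open Summit.QuantumFields.BalabanUV.Beta.SymBorderReflectionLetters (SpureRecOf_succ_inl_inr SpureRecOf_succ_inr_inl SpureRecOf_succ_inr_inr bhKStepSh_succ_inl_inr bhKStepSh_succ_inr_inl bhKStepSh_succ_inr_inr ctGenM_inl_F ctGenM_inr_Q ctGenM_inr_off symVhSAt_inr_inl' symVhSAt_inr_inr' wVH_eq_sq wB2_eq_cube gamma_eq)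

namespace Summit.QuantumFields.BalabanUV.Beta.CombBorderReflectionLetters

variable {Lc : ℕ} [NeZero Lc]

/-- [folklore] **THE BINDER `hBfm` OF THE LITERAL ROOT (field–multiplier legs) — A THEOREM** at `cB := −Lc¹²∕4`, `h2 :=` the product of the two
generator symbols, `RBr := 0` (`Lc` odd; `γ` with the displayed `hγ`). -/
theorem hBfm_comb (hLc : Odd Lc) (cΛ : ℝ) (γ : ℕ → ℝ)
    (hγ : ∀ j, γ j = -((Lc : ℝ) ^ 8 / 2) * wVH 3 Lc j / (stepScale 3 Lc j * (Lc : ℝ) ^ 4)) :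
    ∀ (j : ℕ) (α : Fin 4) (κ : Fin 4) (u : Fin 4 → ℤ) (κ' : Fin 4) (u' : Fin 4 → ℤ) (x z : Fin 4 → ℤ) (β m : Fin 4),
      (((-((Lc : ℝ) ^ 12 / 4)) * wB2 3 Lc (j + 1)) • symVh₂SAn1 3 Lc κ (bref α κ u) κ' (bref α κ' u')) x z (Sum.inl β) (Sum.inr m) =
        ((reflSign α κ * reflSign α κ') • refK (Φ Lc α) (((-((Lc : ℝ) ^ 12 / 4)) * wB2 3 Lc (j + 1)) • symVh₂SAn1 3 Lc κ u κ' u' +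
          conjW (bhKStepSh 3 Lc (Dsh Lc) (j + 1))
            (SpureRecOf 3 Lc (symVhSAt (ctr 4 Lc) 3 Lc rfl) (symHessFFAt (ctr 4 Lc) Lc) (GcombSh Lc) ((Lc : ℝ) ^ 4) (-((Lc : ℝ) ^ 8 / 2)) cΛ (j + 1) κ u)
            (SpureRecOf 3 Lc (symVhSAt (ctr 4 Lc) 3 Lc rfl) (symHessFFAt (ctr 4 Lc) Lc) (GcombSh Lc) ((Lc : ℝ) ^ 4) (-((Lc : ℝ) ^ 8 / 2)) cΛ (j + 1) κ' u')
            (diagK fun p c => γ (j + 1) * ctGenM 3 (bhK Lc + Dsh Lc) α Lc κ u p c) (diagK fun p c => γ (j + 1) * ctGenM 3 (bhK Lc + Dsh Lc) α Lc κ' u' p c)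
            (diagK fun p c => (γ (j + 1) * ctGenM 3 (bhK Lc + Dsh Lc) α Lc κ u p c) * (γ (j + 1) * ctGenM 3 (bhK Lc + Dsh Lc) α Lc κ' u' p c)) +
          (0 : ℕ → Fin 4 → Fin 4 → (Fin 4 → ℤ) → Fin 4 → (Fin 4 → ℤ) → MKer 4 (Fib 3)) (j + 1) α κ u κ' u')) x z (Sum.inl β) (Sum.inr m) := by
  classical
  intro j α κ u κ' u' x z β m
  have hLc1 : 1 ≤ Lc := one_le_of_neZero Lc
  have hγ' := gamma_eq γ hγ (j + 1)
  have e4 : ctr (3 + 1) Lc = ctr 4 Lc := rfl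
  -- unfold the kernel words to entries
  simp only [Pi.smul_apply, Pi.add_apply, Pi.zero_apply, smul_eq_mul, add_zero, refK_apply, Φ_s_inl, Φ_s_inr, Φ_r_inl, Φ_r_inr,
    conjW_diagK_apply, SpureRecOf_succ_inl_inr, bhKStepSh_succ_inl_inr, symVh₂SAn1_inl_inr, symVhSAt_inl_inr', symB_inl_inr,
    ctGenM_inl_F, e4, ← blk_eq_quo]
  by_cases hz : off Lc z = 0
  · have hz' : off Lc (mref Lc α m z) = 0 := (off_mref_eq_zero_iff hLc1 α m z).2 hz
    have hzp : Torus.proj Lc (mref Lc α m z) = 0 := (off_eq_zero_iff_proj _).1 hz'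
    have hblk : blk Lc (mref Lc α m z) = bref α m (blk Lc z) := blk_mref hLc1 α m hz
    simp only [hz, hz', hzp, if_true, ctGenM_inr_Q _ _ _ _ _ hzp, hblk]
    have hB := symBondLaw hLc α m (bref α m (blk Lc z)) β (bref α β x) κ u κ' u'
    simp only [bref_bref] at hB
    have hE : (reflSign α β * reflSign α κ * reflSign α κ' * reflSign α m) * (reflSign α β * reflSign α κ * reflSign α κ' * reflSign α m) = 1 := by
      have h1 := reflSign_mul_self α β; have h2 := reflSign_mul_self α κ; have h3 := reflSign_mul_self α κ'; have h4 := reflSign_mul_self α m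
      calc (reflSign α β * reflSign α κ * reflSign α κ' * reflSign α m) * (reflSign α β * reflSign α κ * reflSign α κ' * reflSign α m)
          = (reflSign α β * reflSign α β) * (reflSign α κ * reflSign α κ) * (reflSign α κ' * reflSign α κ') * (reflSign α m * reflSign α m) := by ring
        _ = 1 := by rw [h1, h2, h3, h4]; ring
    have eL : ((Lc : ℝ) ^ (3 + 1)) = (Lc : ℝ) ^ 4 := by norm_num
    rw [hγ', wB2_eq_cube, wVH_eq_sq, eL]
    set P1 := symVh2KerAt (ctr 4 Lc) Lc m (blk Lc z) (β, x) (κ, bref α κ u) (κ', bref α κ' u') with hP1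
    set P2 := symVh2KerAt (ctr 4 Lc) Lc m (blk Lc z) (β, x) (κ', bref α κ' u') (κ, bref α κ u) with hP2
    set R1 := symVh2KerAt (ctr 4 Lc) Lc m (bref α m (blk Lc z)) (β, bref α β x) (κ, u) (κ', u') with hR1
    set R2 := symVh2KerAt (ctr 4 Lc) Lc m (bref α m (blk Lc z)) (β, bref α β x) (κ', u') (κ, u) with hR2
    set Mg := symVhKerAt (ctr 4 Lc) Lc m (bref α m (blk Lc z)) (β, bref α β x) (κ, u) with hMg
    set Mh := symVhKerAt (ctr 4 Lc) Lc m (bref α m (blk Lc z)) (β, bref α β x) (κ', u') with hMh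
    set Qf := symLinKerAt (ctr 4 Lc) Lc m (bref α m (blk Lc z)) (β, bref α β x) with hQf
    set Qg := (if m = α then symLinKerAt (ctr 4 Lc) Lc m (bref α m (blk Lc z)) (κ, u) else 0) with hQg
    set Qh := (if m = α then symLinKerAt (ctr 4 Lc) Lc m (bref α m (blk Lc z)) (κ', u') else 0) with hQh
    set Fg := (if bref α β x = u ∧ β = κ ∧ κ = α then (1 : ℝ) else 0) with hFg
    set Fh := (if bref α β x = u' ∧ β = κ' ∧ κ' = α then (1 : ℝ) else 0) with hFh
    set σ := stepScale 3 Lc (j + 1) with hσ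
    set E := reflSign α β * reflSign α κ * reflSign α κ' * reflSign α m with hEdef
    linear_combination (1 / 2 * E * (-((Lc : ℝ) ^ 12 / 4) * σ ^ 3)) * hB - (1 / 2 * (-((Lc : ℝ) ^ 12 / 4) * σ ^ 3) * (P1 + P2)) * hE
  · have hz' : ¬ off Lc (mref Lc α m z) = 0 := fun h => hz ((off_mref_eq_zero_iff hLc1 α m z).1 h)
    have hzp : ¬ Torus.proj Lc (mref Lc α m z) = 0 := fun h => hz' ((off_eq_zero_iff_proj _).2 h)
    simp only [hz, hz', hzp, if_false, mul_zero, zero_mul, add_zero]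

/-- [folklore] **THE BINDER `hBmf` OF THE LITERAL ROOT (multiplier–field legs) — A THEOREM** (same data; the anti-twin of `hBfm_comb`: the block leg now
sits at `x`, the fluctuation leg at `z`). -/
theorem hBmf_comb (hLc : Odd Lc) (cΛ : ℝ) (γ : ℕ → ℝ)
    (hγ : ∀ j, γ j = -((Lc : ℝ) ^ 8 / 2) * wVH 3 Lc j / (stepScale 3 Lc j * (Lc : ℝ) ^ 4)) :
    ∀ (j : ℕ) (α : Fin 4) (κ : Fin 4) (u : Fin 4 → ℤ) (κ' : Fin 4) (u' : Fin 4 → ℤ) (x z : Fin 4 → ℤ) (m β : Fin 4),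
      (((-((Lc : ℝ) ^ 12 / 4)) * wB2 3 Lc (j + 1)) • symVh₂SAn1 3 Lc κ (bref α κ u) κ' (bref α κ' u')) x z (Sum.inr m) (Sum.inl β) =
        ((reflSign α κ * reflSign α κ') • refK (Φ Lc α) (((-((Lc : ℝ) ^ 12 / 4)) * wB2 3 Lc (j + 1)) • symVh₂SAn1 3 Lc κ u κ' u' +
          conjW (bhKStepSh 3 Lc (Dsh Lc) (j + 1))
            (SpureRecOf 3 Lc (symVhSAt (ctr 4 Lc) 3 Lc rfl) (symHessFFAt (ctr 4 Lc) Lc) (GcombSh Lc) ((Lc : ℝ) ^ 4) (-((Lc : ℝ) ^ 8 / 2)) cΛ (j + 1) κ u)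
            (SpureRecOf 3 Lc (symVhSAt (ctr 4 Lc) 3 Lc rfl) (symHessFFAt (ctr 4 Lc) Lc) (GcombSh Lc) ((Lc : ℝ) ^ 4) (-((Lc : ℝ) ^ 8 / 2)) cΛ (j + 1) κ' u')
            (diagK fun p c => γ (j + 1) * ctGenM 3 (bhK Lc + Dsh Lc) α Lc κ u p c) (diagK fun p c => γ (j + 1) * ctGenM 3 (bhK Lc + Dsh Lc) α Lc κ' u' p c)
            (diagK fun p c => (γ (j + 1) * ctGenM 3 (bhK Lc + Dsh Lc) α Lc κ u p c) * (γ (j + 1) * ctGenM 3 (bhK Lc + Dsh Lc) α Lc κ' u' p c)) +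
          (0 : ℕ → Fin 4 → Fin 4 → (Fin 4 → ℤ) → Fin 4 → (Fin 4 → ℤ) → MKer 4 (Fib 3)) (j + 1) α κ u κ' u')) x z (Sum.inr m) (Sum.inl β) := by
  classical
  intro j α κ u κ' u' x z m β
  have hLc1 : 1 ≤ Lc := one_le_of_neZero Lc
  have hγ' := gamma_eq γ hγ (j + 1)
  have e4 : ctr (3 + 1) Lc = ctr 4 Lc := rfl
  simp only [Pi.smul_apply, Pi.add_apply, Pi.zero_apply, smul_eq_mul, add_zero, refK_apply, Φ_s_inl, Φ_s_inr, Φ_r_inl, Φ_r_inr,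
    conjW_diagK_apply, SpureRecOf_succ_inr_inl, bhKStepSh_succ_inr_inl, symVh₂SAn1_antiTwin, symVh₂SAn1_inl_inr,
    symVhSAt_inr_inl', symB_inr_inl, ctGenM_inl_F, e4, ← blk_eq_quo]
  by_cases hx : off Lc x = 0
  · have hx' : off Lc (mref Lc α m x) = 0 := (off_mref_eq_zero_iff hLc1 α m x).2 hx
    have hxp : Torus.proj Lc (mref Lc α m x) = 0 := (off_eq_zero_iff_proj _).1 hx'
    have hblk : blk Lc (mref Lc α m x) = bref α m (blk Lc x) := blk_mref hLc1 α m hx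
    simp only [hx, hx', hxp, if_true, ctGenM_inr_Q _ _ _ _ _ hxp, hblk]
    have hB := symBondLaw hLc α m (bref α m (blk Lc x)) β (bref α β z) κ u κ' u'
    simp only [bref_bref] at hB
    have hE : (reflSign α β * reflSign α κ * reflSign α κ' * reflSign α m) * (reflSign α β * reflSign α κ * reflSign α κ' * reflSign α m) = 1 := by
      have h1 := reflSign_mul_self α β; have h2 := reflSign_mul_self α κ; have h3 := reflSign_mul_self α κ'; have h4 := reflSign_mul_self α m
      calc (reflSign α β * reflSign α κ * reflSign α κ' * reflSign α m) * (reflSign α β * reflSign α κ * reflSign α κ' * reflSign α m)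
          = (reflSign α β * reflSign α β) * (reflSign α κ * reflSign α κ) * (reflSign α κ' * reflSign α κ') * (reflSign α m * reflSign α m) := by ring
        _ = 1 := by rw [h1, h2, h3, h4]; ring
    have eL : ((Lc : ℝ) ^ (3 + 1)) = (Lc : ℝ) ^ 4 := by norm_num
    rw [hγ', wB2_eq_cube, wVH_eq_sq, eL]
    set P1 := symVh2KerAt (ctr 4 Lc) Lc m (blk Lc x) (β, z) (κ, bref α κ u) (κ', bref α κ' u') with hP1
    set P2 := symVh2KerAt (ctr 4 Lc) Lc m (blk Lc x) (β, z) (κ', bref α κ' u') (κ, bref α κ u) with hP2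
    set R1 := symVh2KerAt (ctr 4 Lc) Lc m (bref α m (blk Lc x)) (β, bref α β z) (κ, u) (κ', u') with hR1
    set R2 := symVh2KerAt (ctr 4 Lc) Lc m (bref α m (blk Lc x)) (β, bref α β z) (κ', u') (κ, u) with hR2
    set Mg := symVhKerAt (ctr 4 Lc) Lc m (bref α m (blk Lc x)) (β, bref α β z) (κ, u) with hMg
    set Mh := symVhKerAt (ctr 4 Lc) Lc m (bref α m (blk Lc x)) (β, bref α β z) (κ', u') with hMh
    set Qf := symLinKerAt (ctr 4 Lc) Lc m (bref α m (blk Lc x)) (β, bref α β z) with hQf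
    set Qg := (if m = α then symLinKerAt (ctr 4 Lc) Lc m (bref α m (blk Lc x)) (κ, u) else 0) with hQg
    set Qh := (if m = α then symLinKerAt (ctr 4 Lc) Lc m (bref α m (blk Lc x)) (κ', u') else 0) with hQh
    set Fg := (if bref α β z = u ∧ β = κ ∧ κ = α then (1 : ℝ) else 0) with hFg
    set Fh := (if bref α β z = u' ∧ β = κ' ∧ κ' = α then (1 : ℝ) else 0) with hFh
    set σ := stepScale 3 Lc (j + 1) with hσ
    set E := reflSign α β * reflSign α κ * reflSign α κ' * reflSign α m with hEdef
    linear_combination (-(1 / 2 * E * (-((Lc : ℝ) ^ 12 / 4) * σ ^ 3))) * hB + (1 / 2 * (-((Lc : ℝ) ^ 12 / 4) * σ ^ 3) * (P1 + P2)) * hE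
  · have hx' : ¬ off Lc (mref Lc α m x) = 0 := fun h => hx ((off_mref_eq_zero_iff hLc1 α m x).1 h)
    have hxp : ¬ Torus.proj Lc (mref Lc α m x) = 0 := fun h => hx' ((off_eq_zero_iff_proj _).2 h)
    simp only [hx, hx', hxp, if_false, mul_zero, zero_mul, add_zero, neg_zero]

/-- [folklore] **THE BINDER `hBmm` OF THE LITERAL ROOT (two multiplier legs) — A THEOREM**: both sides vanish (`symVh₂SAn1` and `symVhSAt` have no
multiplier–multiplier block; `bhKStepSh (j+1)` is `stepScale (j+1)·Dsh` there, and `Dsh` vanishes there). -/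
theorem hBmm_comb (cΛ : ℝ) (γ : ℕ → ℝ) :
    ∀ (j : ℕ) (α : Fin 4) (κ : Fin 4) (u : Fin 4 → ℤ) (κ' : Fin 4) (u' : Fin 4 → ℤ) (x z : Fin 4 → ℤ) (m m' : Fin 4),
      (((-((Lc : ℝ) ^ 12 / 4)) * wB2 3 Lc (j + 1)) • symVh₂SAn1 3 Lc κ (bref α κ u) κ' (bref α κ' u')) x z (Sum.inr m) (Sum.inr m') =
        ((reflSign α κ * reflSign α κ') • refK (Φ Lc α) (((-((Lc : ℝ) ^ 12 / 4)) * wB2 3 Lc (j + 1)) • symVh₂SAn1 3 Lc κ u κ' u' +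
          conjW (bhKStepSh 3 Lc (Dsh Lc) (j + 1))
            (SpureRecOf 3 Lc (symVhSAt (ctr 4 Lc) 3 Lc rfl) (symHessFFAt (ctr 4 Lc) Lc) (GcombSh Lc) ((Lc : ℝ) ^ 4) (-((Lc : ℝ) ^ 8 / 2)) cΛ (j + 1) κ u)
            (SpureRecOf 3 Lc (symVhSAt (ctr 4 Lc) 3 Lc rfl) (symHessFFAt (ctr 4 Lc) Lc) (GcombSh Lc) ((Lc : ℝ) ^ 4) (-((Lc : ℝ) ^ 8 / 2)) cΛ (j + 1) κ' u')
            (diagK fun p c => γ (j + 1) * ctGenM 3 (bhK Lc + Dsh Lc) α Lc κ u p c) (diagK fun p c => γ (j + 1) * ctGenM 3 (bhK Lc + Dsh Lc) α Lc κ' u' p c)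
            (diagK fun p c => (γ (j + 1) * ctGenM 3 (bhK Lc + Dsh Lc) α Lc κ u p c) * (γ (j + 1) * ctGenM 3 (bhK Lc + Dsh Lc) α Lc κ' u' p c)) +
          (0 : ℕ → Fin 4 → Fin 4 → (Fin 4 → ℤ) → Fin 4 → (Fin 4 → ℤ) → MKer 4 (Fib 3)) (j + 1) α κ u κ' u')) x z (Sum.inr m) (Sum.inr m') := by
  intro j α κ u κ' u' x z m m'
  simp only [Pi.smul_apply, Pi.add_apply, Pi.zero_apply, smul_eq_mul, add_zero, refK_apply, Φ_s_inr, Φ_r_inr,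
    conjW_diagK_apply, SpureRecOf_succ_inr_inr, bhKStepSh_succ_inr_inr, symVh₂SAn1_inr_inr, symVhSAt_inr_inr', Dsh_inr_inr,
    mul_zero, zero_mul, add_zero]

end Summit.QuantumFields.BalabanUV.Beta.CombBorderReflectionLetters

end
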